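import Literature.NumberTheory.LFunctions.SiegelTatuzawaHoffsteinTheoremTwo
import Literature.NumberTheory.LFunctions.DeuringZeroSpacingPhenomenon
import HarnessLib

/-!
# Tatuzawa 1951, Theorem 2 (Jap. J. Math. 21, p. 164) — the discharge of `tatuzawa1951_theorem2`

Topic `Literature/NumberTheory/LFunctions`. Everything in this file is PROVED; its last theorem is
`Literature.NumberTheory.LFunctions.tatuzawa1951_theorem2_holds : tatuzawa1951_theorem2`, discharging the
named fact of `SiegelTatuzawaExplicit.lean`: T. Tatuzawa, *On a theorem of Siegel*, Jap. J. Math. **21**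
(1951) 163–178 [Tatuzawa1951], **Theorem 2** (p. 164): "Let `1 > ε > 0` and `k ≥ Max(e^{1/ε}, e^{11.2})`.
Then `L(1, χ) > 0.655 ε/k^ε` with one possible exception" (`χ` a non-principal primitive real character
to modulus `k`, p. 163), in the tree's rendering `∀ ε ∈ (0,1), AtMostOneException (k ≥ max(e^{1/ε}, e^{11.2})
→ 0.655 ε/k^ε < L(1,χ))`.

## The printed proof (§4, pp. 176–177) and how it is followed

Tatuzawa sets `F(s) = ζ(s)L(s,χ)`, `G(s) = ζ(s)L(s,χ₁)L(s,χ₂)L(s,χ₁χ₂)` (§3 p. 170; non-negative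
Dirichlet coefficients, `≥ 1` at squares, "see [1]" = Estermann 1948) and proves:

* (3) p. 163: `L(1,χ) ≥ 2 log((1+√5)/2)/√k` (class number formula) — whence Theorem 2 for `ε ≥ ½` needs
  no exception ("the proof for `1/2 ≤ ε` and `e^{11.2} ≤ k` is not necessary", p. 176). HERE:
  `lOne_gt_of_half_le`, from the kernel floors `√k·L(1,χ) ≥ 2π/9` (odd) and `≥ 3/4` (even)
  (`sqrt_mul_norm_LFunction_one_ge_of_odd/_of_even`, `DeuringZeroSpacingPhenomenon.lean`).
* Lemma 9 p. 173: `0 < ε < ½`, `k ≥ max(e^{1/ε}, e^{11.2})`, `L(1,χ) ≤ 0.655 ε/k^ε` ⟹ `L(s,χ)` has a real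
  zero in `(1 − ε/4, 1)` (from (29) `F(s) > 1.612 − … − L(1,χ)k^{2(1−s)}/(1−s)`, Estermann's power series
  about `s = 2`, squares `n ≤ 35`). HERE: `lOne_gt_of_ne_zero_eps` / `exists_realZero_of_lOne_le_eps`,
  with `F` handled by Hoffstein's smoothed-Perron master inequality `Hoffstein1980.hoffstein_master`
  (`SiegelTatuzawaHoffsteinLemma.lean`; degree-6 kernel, line `Re s = −3/2 − β`) at `β = 1 − ε/4`,
  `x = k^{5/4}`, squares `m ≤ 200`: `L(1,χ) ≥ (ε/4)(1.6398·k^{−5ε/16} − 2.2·10⁻⁴ k^{−ε}) ≥ 0.69 ε k^{−ε}`.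
* Lemma 10 p. 174: `7/8 ≤ s < 1` ⟹ `G(s) > 1.637 − L(1,χ₁)L(1,χ₂)L(1,χ₁χ₂)(k₁k₂)^{3(1−s)}/(1−s)`
  (`x = (k₁k₂)³`, squares `n ≤ 67`) together with (19) p. 169 `L(1,χ₁χ₂) < 0.606 log k₁k₂`. HERE:
  `core_wide` — the inequality AT A REAL ZERO `β` of `L(s,χ′)` (where `G(β) = 0`), from Hoffstein's
  three-character master inequality `Hoffstein1980.hoffstein_master3` (`SiegelTatuzawaHoffsteinTripleMaster.lean`)
  for `ζ L_χ L_χ′ L_ψ`, `ψ` the primitive character inducing `χχ′` (`exists_primitive_inducer`), at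
  `x = (k₁k₂)²`: `1.63 (1−β)(k₁k₂)^{−2(1−β)} ≤ L(1,χ)L(1,χ′)(½ log k₁k₂ + 1.3)`, Louboutin's
  `L(1,ψ) ≤ ½ log f_ψ + 1.3` (`Louboutin2001.norm_LFunction_one_le_of_isPrimitive`) replacing (19).
* (35)–(37) p. 177: if both `L(1,χ_i) ≤ 0.655 ε/k_i^ε`, the product bound at `s₁ = 1 − 1/(8 log k₁k₂)`
  and `s₂ = 1 − ε/4` ("noting that `(k₁k₂)^ε/ε² ≥ (e²/4) log² k₁k₂`", resp. `(k₁k₂)^{ε/4}/(ε/4) ≥ …`) and the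
  convexity of `(k₁k₂)^{3(1−s)}/(1−s)` give `G > 0` on `[s₂, s₁]`. HERE: `one_sub_lt_of_realZero` — the
  zeros of Lemma 9 satisfy `1 − β_i < 0.31/log k₁k₂`; unimodality of `κ e^{−2κ log k₁k₂}`
  (`min_endpoints_le_mul_exp`, elementary) and the two endpoint inequalities
  `1.63·0.31·e^{−0.62} ≥ 0.192 > 0.130 ≥ 0.429025·4e^{−2}·(½ + 1.3/22.4)` (`sq_mul_exp_neg_le`:
  `u²e^{−u} ≤ 4e^{−2}` for `u = ε log k₁k₂ ≥ 2`) and `0.4075 e^{u/2} ≥ 0.4075(1 + u/2 + u²/8) >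
  0.429025(u/2 + 0.65)`.
* Lemma 11 p. 175 (`G` has at most two real zeros in `[1 − 1/(8 log k₁k₂), 1)`, a Carathéodory–Landau
  count on the circle `K₂`) and the sign change of `G` at `1⁻` then contradict (35). HERE (deviation,
  shorter road): McCurley's explicit Landau theorem `McCurley1984_theorem2_holds`
  (`ExplicitLandauRepulsionStechkin.lean`: two real zeros of distinct real primitive characters satisfy
  `min{β₁,β₂} < 1 − 0.3103/log max(k₁k₂/17, 13)`) contradicts the two zeros above `1 − 0.31/log k₁k₂`
  directly; the wider window `0.31 > 1/8` is what lets the left endpoint of the convexity step be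
  McCurley's instead of Tatuzawa's, and the third-zero/sign-change step is not needed
  (`theorem2_pair`). "With one possible exception" = `AtMostOneException.of_pairwise`.

Constants: Tatuzawa's `1.612` (F), `1.637` (G), `0.606` are replaced by the kernel's `1.6398 − err`
(squares `m ≤ 200`), `1.63`, `½ log + 1.3`; the printed conclusion `0.655 ε/k^ε` and hypotheses
`k ≥ max(e^{1/ε}, e^{11.2})`, `0 < ε < 1` are exactly the printed ones. (Reading note: the print's (36)
evaluates `8·0.655²·0.606·e^{3/8}·4/e² = 1.6382`, displayed as `< 1.637`; immaterial here since the left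
endpoint is McCurley's `0.31/log k₁k₂`, where the margin is a factor `> 1.4`.)

## References

* T. Tatuzawa, On a theorem of Siegel, Jap. J. Math. 21 (1951) 163–178: Thm 2 p. 164, (3) p. 163,
  (19) p. 169, §3 p. 170, Lemmas 9–11 pp. 173–176, §4 pp. 176–177. [Tatuzawa1951]
* J. Hoffstein, On the Siegel–Tatuzawa theorem, Acta Arith. 38 (1980) 167–174, §2–§3 (the master
  inequalities used for Lemmas 9–10). [Hoffstein1980SiegelTatuzawa]
* K. S. McCurley, Explicit zero-free regions for Dirichlet L-functions, J. Number Theory 19 (1984) 7–32,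
  Theorem 2. [McCurley1984ZFR]
* S. Louboutin, Acta Arith. 121 (2006) 199–220, Thm 1 (i) (`|L(1,χ)| ≤ ½ log f + κ`).
  [Louboutin2006RelativeClassNumbers]
-/

noncomputable section

open Complex DirichletCharacter Filter Topology Set
open scoped Real

namespace Literature.NumberTheory.LFunctions.Tatuzawa1951

open Literature.NumberTheory.LFunctions.Hoffstein1980 Literature.NumberTheory.LFunctions.Booker2006Turing

/-! ### Helpers -/

/-- A primitive character modulo `n > 1` is non-trivial. [folklore] -/
private lemma ne_one_of_isPrimitive {n : ℕ} [NeZero n] {φ : DirichletCharacter ℂ n}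
    (hφ : φ.IsPrimitive) (hn : 1 < n) : φ ≠ 1 := by
  rintro rfl
  have h : (1 : DirichletCharacter ℂ n).conductor = n := hφ
  rw [DirichletCharacter.conductor_one] at h; omega

/-- For a quadratic non-trivial `χ`, `L(1, χ)` is real and positive. [folklore] -/
private lemma LFunction_one_re_pos {n : ℕ} [NeZero n] {φ : DirichletCharacter ℂ n} (hφ1 : φ ≠ 1)
    (h2 : φ ^ 2 = 1) : 0 < (φ.LFunction 1).re ∧ ‖φ.LFunction 1‖ = (φ.LFunction 1).re := by
  have him : (φ.LFunction 1).im = 0 := by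
    have := DirichletAbel.LFunction_ofReal_im_eq_zero φ hφ1 h2 (σ := 1) one_pos
    simpa using this
  have hpos : 0 < (φ.LFunction 1).re := by
    have := DirichletAbel.LFunction_ofReal_re_pos_of_forall_ne_zero φ hφ1 h2 one_pos le_rfl
      fun σ h1 h2 ↦ by
        have hσ : σ = 1 := le_antisymm h2 h1
        subst hσ
        exact DirichletCharacter.LFunction_ne_zero_of_one_le_re φ (Or.inl hφ1) (by simp)
    simpa using this
  refine ⟨hpos, ?_⟩
  rw [← Complex.re_add_im (φ.LFunction 1), him]
  simp [abs_of_pos hpos]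

/-- `e ≥ 2.718`, so `e^{11} ≥ 59000` and `e^{7} ≥ 1000` and `e^{14} ≥ 10⁶`. [folklore] -/
private lemma exp_nat_ge (n : ℕ) : (2.718 : ℝ) ^ n ≤ Real.exp n := by
  rw [← Real.exp_one_pow]
  exact pow_le_pow_left₀ (by norm_num) (by linarith [Real.exp_one_gt_d9]) n

/-- From `e^{11.2} ≤ q`: `log q ≥ 11.2`, `q ≥ 59000`. [folklore] -/
private lemma log_ge_of_exp_le {r : ℝ} (hr : Real.exp 11.2 ≤ r) : (11.2 : ℝ) ≤ Real.log r ∧ (59000 : ℝ) ≤ r := by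
  have hr0 : 0 < r := lt_of_lt_of_le (Real.exp_pos _) hr
  refine ⟨?_, ?_⟩
  · have := Real.log_le_log (Real.exp_pos _) hr
    rwa [Real.log_exp] at this
  · have h11 : Real.exp (11 : ℕ) ≤ Real.exp 11.2 := Real.exp_le_exp.2 (by norm_num)
    have h := exp_nat_ge 11
    have : (59000 : ℝ) ≤ (2.718 : ℝ) ^ 11 := by norm_num
    push_cast at h h11
    linarith

/-- From `e^{1/ε} ≤ q` (`ε > 0`): `ε log q ≥ 1`. [folklore] -/
private lemma eps_mul_log_ge {r ε : ℝ} (hε : 0 < ε) (hr : Real.exp (1 / ε) ≤ r) : 1 ≤ ε * Real.log r := by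
  have := Real.log_le_log (Real.exp_pos _) hr
  rw [Real.log_exp, div_le_iff₀' hε] at this
  exact this

/-! ### Part A: `ε ≥ 1/2` — no exception (Tatuzawa's (3), via the class number formula) -/

/-- **The trivial range `½ ≤ ε < 1`** ("the proof for `1/2 ≤ ε` and `e^{11.2} ≤ k` is not necessary",
p. 176, by (3) `L(1,χ) ≥ 2 log((1+√5)/2)/√k`): for every real primitive `χ` mod `q ≥ e^{11.2}`,
`L(1,χ) ≥ 0.69/√q > 0.655 ε/q^ε`. The kernel floors `√q·L(1,χ) ≥ 2π/9` (odd) / `≥ 3/4` (even) replace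
Tatuzawa's `0.96`. [cite: Tatuzawa1951, §4 p. 176 and (3) p. 163] -/
theorem lOne_gt_of_half_le {q : ℕ} [NeZero q] {χ : DirichletCharacter ℂ q} (hχ : χ.IsPrimitive)
    (hquad : χ.IsQuadratic) {ε : ℝ} (hε : 1 / 2 ≤ ε) (hε1 : ε < 1) (hq : Real.exp 11.2 ≤ q) :
    0.655 * ε / (q : ℝ) ^ ε < (χ.LFunction 1).re := by
  obtain ⟨-, hq59⟩ := log_ge_of_exp_le hq
  have hq1r : (1 : ℝ) < q := by linarith
  have hq1 : 1 < q := by exact_mod_cast hq1r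
  have hq0 : (0 : ℝ) < q := by linarith
  have hχ1 := ne_one_of_isPrimitive hχ hq1
  obtain ⟨hpos, hnorm⟩ := LFunction_one_re_pos hχ1 hquad.sq_eq_one
  -- the floor `0.69 ≤ √q · L(1,χ)`
  have hfloor : (0.69 : ℝ) ≤ Real.sqrt q * (χ.LFunction 1).re := by
    rw [← hnorm]
    rcases χ.even_or_odd with heven | hodd
    · exact le_trans (by norm_num) (sqrt_mul_norm_LFunction_one_ge_of_even hq1 hχ hquad heven)
    · have h := sqrt_mul_norm_LFunction_one_ge_of_odd hχ hquad hodd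
      have : (0.69 : ℝ) ≤ 2 * Real.pi / 9 := by linarith [Real.pi_gt_d2]
      exact this.trans h
  -- `q^ε ≥ q^{1/2} = √q`
  have hsqrt : Real.sqrt q = (q : ℝ) ^ (1 / 2 : ℝ) := Real.sqrt_eq_rpow _
  have hqε : Real.sqrt q ≤ (q : ℝ) ^ ε := by
    rw [hsqrt]; exact Real.rpow_le_rpow_of_exponent_le hq1r.le hε
  have hsqrt0 : 0 < Real.sqrt q := Real.sqrt_pos.2 hq0
  have hqε0 : 0 < (q : ℝ) ^ ε := Real.rpow_pos_of_pos hq0 _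
  rw [div_lt_iff₀ hqε0]
  calc 0.655 * ε < 0.69 := by nlinarith
    _ ≤ Real.sqrt q * (χ.LFunction 1).re := hfloor
    _ ≤ (q : ℝ) ^ ε * (χ.LFunction 1).re := by gcongr
    _ = (χ.LFunction 1).re * (q : ℝ) ^ ε := mul_comm _ _

/-! ### Part B1: Tatuzawa's Lemma 9 (a small `L(1,χ)` forces a real zero in `(1 − ε/4, 1)`) -/

open Literature.NumberTheory.LFunctions.DirichletAbel in
/-- **Lemma 9 in Hecke form**: for a real primitive `χ` mod `q ≥ max(e^{1/ε}, e^{11.2})`, `0 < ε ≤ ½`,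
if `L(s,χ) ≠ 0` for real `s ∈ (1 − ε/4, 1)` then `L(1,χ) > 0.655 ε/q^ε`. Tatuzawa (p. 173) gets this from
Estermann's power-series bound (29) `F(s) > 1.612 − … − L(1,χ)k^{2(1−s)}/(1−s)` for `F = ζ L_χ`; here
`F` is handled by Hoffstein's master inequality `Hoffstein1980.hoffstein_master` (degree-6 smoothed
Perron kernel) at `β = 1 − ε/4`, `x = q^{5/4}`: `L(1,χ) ≥ (ε/4)(1.6398 q^{−5ε/16} − 2.2·10⁻⁴ q^{−ε})`
and `q^{11ε/16} ≥ e^{11/16} ≥ 1.6875`, whence `L(1,χ) ≥ 0.69 ε q^{−ε}`.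
[cite: Tatuzawa1951, Lemma 9 p. 173] -/
theorem lOne_gt_of_ne_zero_eps {q : ℕ} [NeZero q] {χ : DirichletCharacter ℂ q} (hχ : χ.IsPrimitive)
    (hquad : χ.IsQuadratic) {ε : ℝ} (hε : 0 < ε) (hε2 : ε ≤ 1 / 2)
    (hqε : Real.exp (1 / ε) ≤ q) (hq : Real.exp 11.2 ≤ q)
    (hz : ∀ σ : ℝ, 1 - ε / 4 < σ → σ < 1 → χ.LFunction σ ≠ 0) :
    0.655 * ε / (q : ℝ) ^ ε < (χ.LFunction 1).re := by
  obtain ⟨hlog, hq59⟩ := log_ge_of_exp_le hq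
  have hu := eps_mul_log_ge hε hqε
  have hq1r : (1 : ℝ) < q := by linarith
  have hq1 : 1 < q := by exact_mod_cast hq1r
  have hq0 : (0 : ℝ) < q := by linarith
  have hχ1 := ne_one_of_isPrimitive hχ hq1
  have hq2 : χ ^ 2 = 1 := hquad.sq_eq_one
  set β : ℝ := 1 - ε / 4 with hβ
  have hβ1 : β < 1 := by rw [hβ]; linarith
  have hβ0 : 1 / 2 < β := by rw [hβ]; linarith
  have hκ : 1 - β = ε / 4 := by rw [hβ]; ring
  -- `L(β, χ) ≥ 0`: positive on `(β, 1]`, continuous at `β`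
  have hpos : ∀ σ : ℝ, β < σ → σ ≤ 1 → 0 < (χ.LFunction σ).re := fun σ h1 h2 ↦
    LFunction_ofReal_re_pos_of_forall_ne_zero χ hχ1 hq2 (by linarith) h2 fun τ hτ1 hτ2 ↦ by
      rcases eq_or_lt_of_le hτ2 with rfl | hlt
      · rw [ofReal_one]; exact LFunction_apply_one_ne_zero hχ1
      · exact hz τ (by rw [hβ] at h1; linarith) hlt
  have hLβ : 0 ≤ (χ.LFunction β).re := by
    have hcont : Continuous fun σ : ℝ ↦ (χ.LFunction σ).re :=
      continuous_re.comp ((differentiable_LFunction hχ1).continuous.comp continuous_ofReal)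
    have ht : Tendsto (fun σ : ℝ ↦ (χ.LFunction σ).re) (𝓝[>] β) (𝓝 ((χ.LFunction β).re)) :=
      tendsto_nhdsWithin_of_tendsto_nhds (hcont.tendsto β)
    refine ge_of_tendsto ht ?_
    filter_upwards [Ioo_mem_nhdsGT hβ1] with σ hσ
    exact (hpos σ hσ.1 hσ.2.le).le
  -- the choice `x = q^{5/4} ≥ e^{14} ≥ 10⁶`
  set x : ℝ := (q : ℝ) ^ (5 / 4 : ℝ) with hxdef
  have hx0 : 0 < x := Real.rpow_pos_of_pos hq0 _
  have hx6 : (10 : ℝ) ^ 6 ≤ x := by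
    have h1 : Real.exp 14 ≤ x := by
      rw [hxdef, Real.rpow_def_of_pos hq0, Real.exp_le_exp]; nlinarith
    have h2 := exp_nat_ge 14
    push_cast at h2
    have : (10 : ℝ) ^ 6 ≤ (2.718 : ℝ) ^ 14 := by norm_num
    linarith
  have hM := hoffstein_master hq1 hχ hquad hβ0 hβ1 hLβ (x := x) (by linarith)
  -- (i) the squares sum
  have hSm := sum200_ge hx6
  -- (ii) `x^{-(1-β)} = q^{-ε} · q^{11ε/16} ≥ 1.6875 q^{-ε}`
  have hqε0 : 0 < (q : ℝ) ^ (-ε) := Real.rpow_pos_of_pos hq0 _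
  have hxκ : 1.6875 * (q : ℝ) ^ (-ε) ≤ x ^ (-(1 - β)) := by
    rw [hκ, hxdef, ← Real.rpow_mul hq0.le]
    have e1 : (5 / 4 : ℝ) * (-(ε / 4)) = -ε + 11 / 16 * ε := by ring
    rw [e1, Real.rpow_add hq0, mul_comm (1.6875 : ℝ)]
    refine mul_le_mul_of_nonneg_left ?_ hqε0.le
    rw [Real.rpow_def_of_pos hq0]
    have h1 : (11 / 16 : ℝ) ≤ Real.log q * (11 / 16 * ε) := by nlinarith
    calc (1.6875 : ℝ) = 11 / 16 + 1 := by norm_num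
      _ ≤ Real.exp (11 / 16) := Real.add_one_le_exp _
      _ ≤ Real.exp (Real.log q * (11 / 16 * ε)) := Real.exp_le_exp.2 h1
  -- (iii) the error term `≤ 0.00022 q^{-ε}`
  have hE : hoffErrConst q (1 - β) * x ^ (-(5 / 2 : ℝ)) ≤ 0.00022 * (q : ℝ) ^ (-ε) := by
    have hκ8 : 1 - β ≤ 1 / 8 := by rw [hκ]; linarith
    have hC := hoffErrConst_le hκ8 (by norm_num) q
    have hnum : (45 * 1.9955 * ((5 / 4) / ((5 / 2 - 1 / 8) * (1 / 2 - 1 / 8))) /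
        (2 * 97.4 * 2.958) : ℝ) ≤ 0.2188 := by norm_num
    have hx52 : x ^ (-(5 / 2 : ℝ)) = (q : ℝ) ^ (-(25 / 8 : ℝ)) := by
      rw [hxdef, ← Real.rpow_mul hq0.le]; norm_num
    -- `q² q^{-25/8} = q^{-1/2} q^{-5/8} ≤ q^{-ε}/1000`
    have hq58 : (q : ℝ) ^ (-(5 / 8 : ℝ)) ≤ 1 / 1000 := by
      rw [Real.rpow_def_of_pos hq0]
      have h7 : Real.log q * (-(5 / 8 : ℝ)) ≤ -(7 : ℕ) := by push_cast; nlinarith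
      refine (Real.exp_le_exp.2 h7).trans ?_
      rw [Real.exp_neg, one_div]
      refine inv_anti₀ (by norm_num) ?_
      have := exp_nat_ge 7
      exact le_trans (by norm_num) this
    have hqhalf : (q : ℝ) ^ (-(1 / 2 : ℝ)) ≤ (q : ℝ) ^ (-ε) :=
      Real.rpow_le_rpow_of_exponent_le hq1r.le (by linarith)
    have hprod : (q : ℝ) ^ 2 * (q : ℝ) ^ (-(25 / 8 : ℝ)) ≤ (q : ℝ) ^ (-ε) * (1 / 1000) := by
      have e : (q : ℝ) ^ 2 * (q : ℝ) ^ (-(25 / 8 : ℝ)) = (q : ℝ) ^ (-(1 / 2 : ℝ)) * (q : ℝ) ^ (-(5 / 8 : ℝ)) := by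
        rw [← Real.rpow_natCast, ← Real.rpow_add hq0, ← Real.rpow_add hq0]; norm_num
      rw [e]
      exact mul_le_mul hqhalf hq58 (Real.rpow_pos_of_pos hq0 _).le hqε0.le
    calc hoffErrConst q (1 - β) * x ^ (-(5 / 2 : ℝ))
        ≤ (q : ℝ) ^ 2 * 0.2188 * x ^ (-(5 / 2 : ℝ)) := by
          gcongr
          exact hC.trans (by gcongr)
      _ = 0.2188 * ((q : ℝ) ^ 2 * (q : ℝ) ^ (-(25 / 8 : ℝ))) := by rw [hx52]; ring
      _ ≤ 0.2188 * ((q : ℝ) ^ (-ε) * (1 / 1000)) := by gcongr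
      _ ≤ 0.00022 * (q : ℝ) ^ (-ε) := by nlinarith
  -- assembly: `L(1) ≥ (ε/4)(1.6875·1.6398 − 0.00022) q^{-ε} > 0.655 ε q^{-ε}`
  have hS0 : (0 : ℝ) ≤ ∑ m ∈ Finset.range 200, (1 / ((m : ℝ) + 1) ^ 2 - 15 * ((m : ℝ) + 1) ^ 2 / x ^ 2) :=
    le_trans (by norm_num) hSm
  have hprod : 1.6875 * (q : ℝ) ^ (-ε) * 1.6398 ≤ x ^ (-(1 - β)) *
      ∑ m ∈ Finset.range 200, (1 / ((m : ℝ) + 1) ^ 2 - 15 * ((m : ℝ) + 1) ^ 2 / x ^ 2) :=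
    mul_le_mul hxκ hSm (by norm_num) (le_trans (by positivity) hxκ)
  have hbr : 2.76 * (q : ℝ) ^ (-ε) ≤ x ^ (-(1 - β)) *
      ∑ m ∈ Finset.range 200, (1 / ((m : ℝ) + 1) ^ 2 - 15 * ((m : ℝ) + 1) ^ 2 / x ^ 2) -
      hoffErrConst q (1 - β) * x ^ (-(5 / 2 : ℝ)) := by
    nlinarith
  have hfin : 0.655 * ε * (q : ℝ) ^ (-ε) < (χ.LFunction 1).re := by
    calc 0.655 * ε * (q : ℝ) ^ (-ε) < (1 - β) * (2.76 * (q : ℝ) ^ (-ε)) := by rw [hκ]; nlinarith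
      _ ≤ (1 - β) * (x ^ (-(1 - β)) *
          ∑ m ∈ Finset.range 200, (1 / ((m : ℝ) + 1) ^ 2 - 15 * ((m : ℝ) + 1) ^ 2 / x ^ 2) -
          hoffErrConst q (1 - β) * x ^ (-(5 / 2 : ℝ))) :=
          mul_le_mul_of_nonneg_left hbr (by linarith)
      _ ≤ (χ.LFunction 1).re := hM
  rwa [Real.rpow_neg hq0.le, ← div_eq_mul_inv] at hfin

/-- **Lemma 9 as printed** (existence form): `0 < ε ≤ ½`, `q ≥ max(e^{1/ε}, e^{11.2})`,
`L(1,χ) ≤ 0.655 ε/q^ε` ⟹ `L(s,χ)` has a real zero in `(1 − ε/4, 1)`.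
[cite: Tatuzawa1951, Lemma 9 p. 173] -/
theorem exists_realZero_of_lOne_le_eps {q : ℕ} [NeZero q] {χ : DirichletCharacter ℂ q}
    (hχ : χ.IsPrimitive) (hquad : χ.IsQuadratic) {ε : ℝ} (hε : 0 < ε) (hε2 : ε ≤ 1 / 2)
    (hqε : Real.exp (1 / ε) ≤ q) (hq : Real.exp 11.2 ≤ q)
    (hL : (χ.LFunction 1).re ≤ 0.655 * ε / (q : ℝ) ^ ε) :
    ∃ β : ℝ, 1 - ε / 4 < β ∧ β < 1 ∧ χ.LFunction β = 0 := by
  by_contra hne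
  push Not at hne
  have hz : ∀ σ : ℝ, 1 - ε / 4 < σ → σ < 1 → χ.LFunction σ ≠ 0 := fun σ h1 h2 h0 ↦ hne σ h1 h2 h0
  exact absurd hL (not_le.2 (lOne_gt_of_ne_zero_eps hχ hquad hε hε2 hqε hq hz))

/-! ### Part B2: Tatuzawa's Lemma 10 at a zero (three characters, window `1 − β ≤ 1/8`) -/

/-- **Lemma 10 at a real zero, via the three-character master inequality.** For real primitive
`χ ≠ χ′` mod `q, q′ > 1` with `qq′ ≥ 10⁶` and a real zero `β ∈ [7/8, 1)` of `L(s, χ′)`: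
`1.63 (1 − β) (qq′)^{−2(1−β)} ≤ L(1,χ) L(1,χ′) (½ log qq′ + 1.3)`. Tatuzawa's Lemma 10 (p. 174) is
`G(s) > 1.637 − L(1,χ₁)L(1,χ₂)L(1,χ₁χ₂)(k₁k₂)^{3(1−s)}/(1−s)` for `G = ζ L_{χ₁} L_{χ₂} L_{χ₁χ₂}`,
`7/8 ≤ s < 1` (Estermann power series, `x = (k₁k₂)³`, squares `n ≤ 67`), combined with (19)
`L(1,χ₁χ₂) < 0.606 log k₁k₂`; here: Hoffstein's `hoffstein_master3` for `ζ L_χ L_χ′ L_ψ` (`ψ` the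
primitive inducer of `χχ′`, `exists_primitive_inducer`) at `x = (qq′)²`, squares `m ≤ 200`
(`sum200_ge`: `1.6398`, error `≤ 3.9 (qq′)^{−1/2} ≤ 0.0039`), and Louboutin's `L(1,ψ) ≤ ½ log k + 1.3`
(`Louboutin2001.norm_LFunction_one_le_of_isPrimitive`) for (19).
[cite: Tatuzawa1951, Lemma 10 p. 174 and (19) p. 169] -/
theorem core_wide {q q' : ℕ} [NeZero q] [NeZero q'] (χ : DirichletCharacter ℂ q)
    (χ' : DirichletCharacter ℂ q') (hχp : χ.IsPrimitive) (hχq : χ.IsQuadratic)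
    (hχ'p : χ'.IsPrimitive) (hχ'q : χ'.IsQuadratic) (hne : (fun n : ℕ ↦ χ n) ≠ fun n : ℕ ↦ χ' n)
    (hq : 1 < q) (hq' : 1 < q') (hN6 : (10 : ℝ) ^ 6 ≤ (q : ℝ) * q')
    {β : ℝ} (hz : χ'.LFunction β = 0) (hβlo : 7 / 8 ≤ β) (hβ1 : β < 1) :
    1.63 * (1 - β) * ((q : ℝ) * q') ^ (-(2 * (1 - β))) ≤
      (χ.LFunction 1).re * ((χ'.LFunction 1).re * (Real.log ((q : ℝ) * q') / 2 + 1.3)) := by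
  have hq0 : (0 : ℝ) < q := by exact_mod_cast (zero_lt_one.trans hq)
  have hq'0 : (0 : ℝ) < q' := by exact_mod_cast (zero_lt_one.trans hq')
  set N : ℝ := (q : ℝ) * q' with hN
  have hN0 : 0 < N := by positivity
  have hN1 : (1 : ℝ) ≤ N := le_trans (by norm_num) hN6
  have hχ1 := ne_one_of_isPrimitive hχp hq
  have hχ'1 := ne_one_of_isPrimitive hχ'p hq'
  have h2 : χ ^ 2 = 1 := hχq.sq_eq_one
  have h2' : χ' ^ 2 = 1 := hχ'q.sq_eq_one
  obtain ⟨hLpos, -⟩ := LFunction_one_re_pos hχ1 h2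
  obtain ⟨hL'pos, -⟩ := LFunction_one_re_pos hχ'1 h2'
  have hκ0 : 0 < 1 - β := by linarith
  have hβ0 : 1 / 2 < β := by linarith
  -- the third character `ψ`
  obtain ⟨k, hkI, ψ, hk1, hkdvd, hψp, hψ2, hψ1, hlink, -⟩ :=
    exists_primitive_inducer χ χ' hχp hχ'p h2 h2' hne
  obtain ⟨hLψpos, hLψnorm⟩ := LFunction_one_re_pos hψ1 hψ2
  have hkle : (k : ℝ) ≤ N := by
    rw [hN]
    exact_mod_cast Nat.le_of_dvd (Nat.pos_of_ne_zero (mul_ne_zero (NeZero.ne q) (NeZero.ne q'))) hkdvd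
  have hk0 : (0 : ℝ) < k := by exact_mod_cast (zero_lt_one.trans hk1)
  -- (19): `L(1,ψ) ≤ ½ log k + 1.3 ≤ ½ log N + 1.3 =: u`
  set u : ℝ := Real.log N / 2 + 1.3 with hu
  have hlogN0 : 0 ≤ Real.log N := Real.log_nonneg hN1
  have hLψle : (ψ.LFunction 1).re ≤ u := by
    have h := Louboutin2001.norm_LFunction_one_le_of_isPrimitive (χ := ψ) hψp hψ1
    rw [hLψnorm] at h
    have : Real.log k ≤ Real.log N := Real.log_le_log hk0 hkle
    rw [hu]; linarith
  have hu0 : 0 < u := by rw [hu]; positivity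
  -- the choice `x = N²`
  set x : ℝ := N ^ (2 : ℝ) with hxdef
  have hx0 : 0 < x := Real.rpow_pos_of_pos hN0 _
  have hxN : N ≤ x := by
    rw [hxdef]
    calc N = N ^ (1 : ℝ) := (Real.rpow_one N).symm
      _ ≤ N ^ (2 : ℝ) := Real.rpow_le_rpow_of_exponent_le hN1 (by norm_num)
  have hx6 : (10 : ℝ) ^ 6 ≤ x := hN6.trans hxN
  have hx4 : (40000 : ℝ) ≤ x := le_trans (by norm_num) hx6
  -- the master inequality
  have hFβ : hoffF χ χ' ψ β = 0 := hoffF_eq_zero_of_LFunction_eq_zero hz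
  have hM := hoffstein_master3 hq hq' hk1 hχp hχ'p hψp h2 h2' hψ2 hlink hβ0 hβ1 hFβ hx4
  -- numerics (a): the squares sum
  have hSm := sum200_ge hx6
  -- numerics (b): the error term `C₃ x^{-3/2} ≤ 3.9 N² N^{-3} = 3.9 N^{-1}`
  have hx32 : x ^ (-(3 / 2 : ℝ)) = N ^ (-(3 : ℝ)) := by
    rw [hxdef, ← Real.rpow_mul hN0.le]; norm_num
  have hE : hoffErr3 q q' k * x ^ (-(3 / 2 : ℝ)) ≤ 3.9 * N ^ (-(1 : ℝ)) := by
    rw [hoffErr3, hx32]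
    have hqqk : (q : ℝ) * q' * k ≤ N * N := by rw [hN]; gcongr
    have hNN : N * N * N ^ (-(3 : ℝ)) = N ^ (-(1 : ℝ)) := by
      rw [show N * N = N ^ (2 : ℝ) by rw [Real.rpow_two]; ring, ← Real.rpow_add hN0]; norm_num
    have hZ0 : 0 ≤ bigZ (3 / 2) := (bigZ_pos (by norm_num)).le
    calc 720 * ((q : ℝ) * q' * k) * bigZ (3 / 2) ^ 4 / (7 * (2 * π) ^ 4) * N ^ (-(3 : ℝ))
        = (720 * bigZ (3 / 2) ^ 4 / (7 * (2 * π) ^ 4)) * (((q : ℝ) * q' * k) * N ^ (-(3 : ℝ))) := by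
          ring
      _ ≤ 3.9 * ((N * N) * N ^ (-(3 : ℝ))) := by gcongr; exact errConst3_le
      _ = 3.9 * N ^ (-(1 : ℝ)) := by rw [hNN]
  --   `x^{1−β} = N^{2(1−β)} ≤ N^{1/2}` and `N^{-1} N^{1/2} = N^{−1/2} ≤ 1/1000`
  have hxκ_le : x ^ (1 - β) ≤ N ^ (1 / 2 : ℝ) := by
    rw [hxdef, ← Real.rpow_mul hN0.le]
    exact Real.rpow_le_rpow_of_exponent_le hN1 (by linarith)
  have hNhalf : N ^ (-(1 / 2 : ℝ)) ≤ 1 / 1000 := by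
    have h1 : (1000 : ℝ) ≤ N ^ (1 / 2 : ℝ) := by
      have hy : 0 ≤ N ^ (1 / 2 : ℝ) := Real.rpow_nonneg hN0.le _
      have h5 : (N ^ (1 / 2 : ℝ)) ^ (2 : ℕ) = N := by
        rw [← Real.rpow_natCast, ← Real.rpow_mul hN0.le]; norm_num
      by_contra hlt
      push Not at hlt
      have : (N ^ (1 / 2 : ℝ)) ^ (2 : ℕ) < 1000 ^ 2 := pow_lt_pow_left₀ hlt hy (by norm_num)
      rw [h5] at this
      linarith
    rw [Real.rpow_neg hN0.le]
    exact (inv_le_inv₀ (by positivity) (by norm_num)).2 h1 |>.trans (by norm_num)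
  have hEx : hoffErr3 q q' k * x ^ (-(3 / 2 : ℝ)) * x ^ (1 - β) ≤ 0.0039 := by
    have h1 : hoffErr3 q q' k * x ^ (-(3 / 2 : ℝ)) * x ^ (1 - β) ≤
        3.9 * N ^ (-(1 : ℝ)) * N ^ (1 / 2 : ℝ) :=
      mul_le_mul hE hxκ_le (Real.rpow_pos_of_pos hx0 _).le (by positivity)
    have h2 : N ^ (-(1 : ℝ)) * N ^ (1 / 2 : ℝ) = N ^ (-(1 / 2 : ℝ)) := by
      rw [← Real.rpow_add hN0]; norm_num
    calc hoffErr3 q q' k * x ^ (-(3 / 2 : ℝ)) * x ^ (1 - β)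
        ≤ 3.9 * (N ^ (-(1 : ℝ)) * N ^ (1 / 2 : ℝ)) := by rw [← mul_assoc]; exact h1
      _ = 3.9 * N ^ (-(1 / 2 : ℝ)) := by rw [h2]
      _ ≤ 3.9 * (1 / 1000) := by gcongr
      _ = 0.0039 := by norm_num
  -- from the master inequality to `1.63 (1−β) x^{−(1−β)} ≤ L(1,χ) L(1,χ′) L(1,ψ)`
  set Sm : ℝ := ∑ m ∈ Finset.range 200, (1 / ((m : ℝ) + 1) ^ 2 - 15 * ((m : ℝ) + 1) ^ 2 / x ^ 2)
    with hSmdef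
  set P : ℝ := (χ.LFunction 1).re * ((χ'.LFunction 1).re * (ψ.LFunction 1).re) with hP
  set E : ℝ := hoffErr3 q q' k * x ^ (-(3 / 2 : ℝ)) with hEdef
  have hxκ0 : 0 < x ^ (-(1 - β)) := Real.rpow_pos_of_pos hx0 _
  have hxinv : x ^ (-(1 - β)) * x ^ (1 - β) = 1 := by rw [← Real.rpow_add hx0]; simp
  have hA : 1.63 * (1 - β) * x ^ (-(1 - β)) ≤ P := by
    have h1 : x ^ (-(1 - β)) * Sm - E = x ^ (-(1 - β)) * (Sm - E * x ^ (1 - β)) := by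
      have : E = x ^ (-(1 - β)) * (E * x ^ (1 - β)) := by
        rw [show x ^ (-(1 - β)) * (E * x ^ (1 - β)) = E * (x ^ (-(1 - β)) * x ^ (1 - β)) by ring,
          hxinv, mul_one]
      conv_lhs => rw [this]
      ring
    rw [h1] at hM
    have h2 : (1.63 : ℝ) ≤ Sm - E * x ^ (1 - β) := by linarith
    calc 1.63 * (1 - β) * x ^ (-(1 - β)) = (1 - β) * (x ^ (-(1 - β)) * 1.63) := by ring
      _ ≤ (1 - β) * (x ^ (-(1 - β)) * (Sm - E * x ^ (1 - β))) := by gcongr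
      _ ≤ P := hM
  have hxκeq : x ^ (-(1 - β)) = N ^ (-(2 * (1 - β))) := by
    rw [hxdef, ← Real.rpow_mul hN0.le]; congr 1; ring
  calc 1.63 * (1 - β) * N ^ (-(2 * (1 - β))) = 1.63 * (1 - β) * x ^ (-(1 - β)) := by rw [hxκeq]
    _ ≤ P := hA
    _ ≤ (χ.LFunction 1).re * ((χ'.LFunction 1).re * u) := by rw [hP]; gcongr

/-! ### Part B3: (36)–(37) and the convexity step, on the window `[0.31/log k₁k₂, ε/4]` -/

/-- `f(κ) = κ e^{−2κL}` is unimodal (increasing up to `κ = 1/(2L)`, decreasing after), so on a segment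
`a ≤ κ ≤ b` it is at least `min(f(a), f(b))` (Tatuzawa p. 177: "Since `(k₁k₂)^{3(1−s)}/(1−s)` is
convex for `0 < s < 1`, we can see from (36), (37) …"). Elementary: `e^t ≥ 1 + t`.
[cite: Tatuzawa1951, §4 p. 177 (the convexity step between (36)–(37) and Lemma 10)] -/
theorem min_endpoints_le_mul_exp {L a b κ : ℝ} (hL : 0 < L) (ha : 0 ≤ a) (haκ : a ≤ κ) (hκb : κ ≤ b) :
    min (a * Real.exp (-(2 * a * L))) (b * Real.exp (-(2 * b * L))) ≤
      κ * Real.exp (-(2 * κ * L)) := by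
  have hκ0 : 0 ≤ κ := ha.trans haκ
  rcases le_or_gt κ (1 / (2 * L)) with hle | hgt
  · -- increasing branch: `f(a) ≤ f(κ)`
    refine (min_le_left _ _).trans ?_
    have h2 : κ * (2 * L) ≤ 1 := by rwa [le_div_iff₀ (by positivity)] at hle
    have key : a ≤ κ * Real.exp (-(2 * (κ - a) * L)) := by
      have h1 : 1 + -(2 * (κ - a) * L) ≤ Real.exp (-(2 * (κ - a) * L)) := by
        have := Real.add_one_le_exp (-(2 * (κ - a) * L)); linarith
      calc a ≤ κ * (1 + -(2 * (κ - a) * L)) := by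
            nlinarith [mul_nonneg (sub_nonneg.2 haκ) (sub_nonneg.2 h2)]
        _ ≤ κ * Real.exp (-(2 * (κ - a) * L)) := mul_le_mul_of_nonneg_left h1 hκ0
    have e : Real.exp (-(2 * κ * L)) =
        Real.exp (-(2 * (κ - a) * L)) * Real.exp (-(2 * a * L)) := by
      rw [← Real.exp_add]; congr 1; ring
    rw [e, ← mul_assoc]
    exact mul_le_mul_of_nonneg_right key (Real.exp_pos _).le
  · -- decreasing branch: `f(b) ≤ f(κ)`
    refine (min_le_right _ _).trans ?_
    have h2 : 1 < κ * (2 * L) := by rwa [div_lt_iff₀ (by positivity)] at hgt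
    have key : b ≤ κ * Real.exp (2 * (b - κ) * L) := by
      have h1 : 1 + 2 * (b - κ) * L ≤ Real.exp (2 * (b - κ) * L) := by
        have := Real.add_one_le_exp (2 * (b - κ) * L); linarith
      calc b ≤ κ * (1 + 2 * (b - κ) * L) := by
            nlinarith [mul_nonneg (sub_nonneg.2 hκb) (sub_nonneg.2 h2.le)]
        _ ≤ κ * Real.exp (2 * (b - κ) * L) := mul_le_mul_of_nonneg_left h1 hκ0
    have e : Real.exp (-(2 * κ * L)) =
        Real.exp (2 * (b - κ) * L) * Real.exp (-(2 * b * L)) := by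
      rw [← Real.exp_add]; congr 1; ring
    rw [e, ← mul_assoc]
    exact mul_le_mul_of_nonneg_right key (Real.exp_pos _).le

/-- `u² e^{−u} ≤ 4 e^{−2}` for `u ≥ 2` (the source: "noting that `(k₁k₂)^ε/ε² ≥ (e²/4) log²(k₁k₂)`",
p. 177, (36)). [cite: Tatuzawa1951, §4 (36) p. 177] -/
theorem sq_mul_exp_neg_le {u : ℝ} (hu : 2 ≤ u) : u ^ 2 * Real.exp (-u) ≤ 4 * Real.exp (-2) := by
  have ht : 0 ≤ u - 2 := by linarith
  have hq := Real.quadratic_le_exp_of_nonneg ht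
  -- `e^{u-2} ≥ 1 + (u-2) + (u-2)²/2 ≥ u²/4`
  have h4 : u ^ 2 / 4 ≤ Real.exp (u - 2) := by nlinarith [sq_nonneg (u - 2)]
  have hpos : 0 < Real.exp (u - 2) := Real.exp_pos _
  have e : Real.exp (-u) = Real.exp (-2) * (Real.exp (u - 2))⁻¹ := by
    rw [← Real.exp_neg, ← Real.exp_add]; congr 1; ring
  rw [e]
  have : u ^ 2 * (Real.exp (u - 2))⁻¹ ≤ 4 := by
    rw [← div_eq_mul_inv, div_le_iff₀ hpos]; linarith
  calc u ^ 2 * (Real.exp (-2) * (Real.exp (u - 2))⁻¹)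
      = Real.exp (-2) * (u ^ 2 * (Real.exp (u - 2))⁻¹) := by ring
    _ ≤ Real.exp (-2) * 4 := by gcongr
    _ = 4 * Real.exp (-2) := by ring

/-- `e^{−2} ≤ 0.1356`. [folklore] -/
private lemma exp_neg_two_le : Real.exp (-2) ≤ 0.1356 := by
  have h := exp_nat_ge 2
  push_cast at h
  rw [Real.exp_neg]
  calc (Real.exp 2)⁻¹ ≤ ((2.718 : ℝ) ^ 2)⁻¹ := inv_anti₀ (by norm_num) h
    _ ≤ 0.1356 := by norm_num

/-- **(36)–(37) with McCurley's window: no zero of `L(s, χ′)` in `[1 − ε/4, 1 − 0.31/log qq′]`.** For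
real primitive `χ ≠ χ′` mod `q, q′ ≥ max(e^{1/ε}, e^{11.2})`, `0 < ε < ½`, with `L(1,χ) ≤ 0.655 ε/q^ε`
and `L(1,χ′) ≤ 0.655 ε/q′^ε`, every real zero `β ∈ (1 − ε/4, 1)` of `L(s,χ′)` has
`1 − β < 0.31/log(qq′)`. (Tatuzawa, (36)–(37) p. 177: at `s₁ = 1 − 1/(8 log k₁k₂)` and `s₂ = 1 − ε/4`
the product `L(1,χ₁)L(1,χ₂)L(1,χ₁χ₂)(k₁k₂)^{3(1−s)}/(1−s)` is `< 1.637`, so `G > 0` on `[s₂, s₁]` by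
Lemma 10 and convexity; here Lemma 10 is used AT the zero (`core_wide`), the left endpoint is McCurley's
`0.31/log k₁k₂` instead of `1/(8 log k₁k₂)`, and the two endpoint inequalities are
`1.63·0.31·e^{−0.62} > 0.429·4e^{−2}·(½ + 1.3/22.4)` and `0.4075 e^{u/2} > 0.429 (u/2 + 0.65)`,
`u = ε log qq′ ≥ 2`.) [cite: Tatuzawa1951, §4 (36)–(37) p. 177] -/
theorem one_sub_lt_of_realZero {q q' : ℕ} [NeZero q] [NeZero q'] (χ : DirichletCharacter ℂ q)
    (χ' : DirichletCharacter ℂ q') (hχp : χ.IsPrimitive) (hχq : χ.IsQuadratic)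
    (hχ'p : χ'.IsPrimitive) (hχ'q : χ'.IsQuadratic) (hne : (fun n : ℕ ↦ χ n) ≠ fun n : ℕ ↦ χ' n)
    {ε : ℝ} (hε : 0 < ε) (hε2 : ε < 1 / 2)
    (hqε : Real.exp (1 / ε) ≤ q) (hq11 : Real.exp 11.2 ≤ q)
    (hq'ε : Real.exp (1 / ε) ≤ q') (hq'11 : Real.exp 11.2 ≤ q')
    (hL : (χ.LFunction 1).re ≤ 0.655 * ε / (q : ℝ) ^ ε)
    (hL' : (χ'.LFunction 1).re ≤ 0.655 * ε / (q' : ℝ) ^ ε)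
    {β : ℝ} (hz : χ'.LFunction β = 0) (hβlo : 1 - ε / 4 < β) (hβ1 : β < 1) :
    1 - β < 0.31 / Real.log ((q : ℝ) * q') := by
  obtain ⟨hlog, hq59⟩ := log_ge_of_exp_le hq11
  obtain ⟨hlog', hq'59⟩ := log_ge_of_exp_le hq'11
  have hu1 := eps_mul_log_ge hε hqε
  have hu2 := eps_mul_log_ge hε hq'ε
  have hq0 : (0 : ℝ) < q := by linarith
  have hq'0 : (0 : ℝ) < q' := by linarith
  have hq1 : 1 < q := by exact_mod_cast (show (1 : ℝ) < q by linarith)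
  have hq'1 : 1 < q' := by exact_mod_cast (show (1 : ℝ) < q' by linarith)
  set N : ℝ := (q : ℝ) * q' with hN
  have hN0 : 0 < N := by positivity
  set L : ℝ := Real.log N with hLdef
  have hLsum : L = Real.log q + Real.log q' := by rw [hLdef, hN, Real.log_mul hq0.ne' hq'0.ne']
  have hL22 : (22.4 : ℝ) ≤ L := by rw [hLsum]; linarith
  have hL0 : 0 < L := by linarith
  have huL : 2 ≤ ε * L := by rw [hLsum, mul_add]; linarith
  have hN6 : (10 : ℝ) ^ 6 ≤ N := by rw [hN]; nlinarith
  by_contra hcon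
  push Not at hcon
  set κ : ℝ := 1 - β with hκdef
  have hκ0 : 0 < κ := by rw [hκdef]; linarith
  have hκε : κ ≤ ε / 4 := by rw [hκdef]; linarith
  have hβ78 : 7 / 8 ≤ β := by linarith
  -- Lemma 10 at the zero
  have hcore := core_wide χ χ' hχp hχq hχ'p hχ'q hne hq1 hq'1 hN6 hz hβ78 hβ1
  -- the product `L(1,χ) L(1,χ′) ≤ 0.655² ε² N^{−ε}`
  have hχ1 := ne_one_of_isPrimitive hχp hq1
  have hχ'1 := ne_one_of_isPrimitive hχ'p hq'1
  obtain ⟨hLpos, -⟩ := LFunction_one_re_pos hχ1 hχq.sq_eq_one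
  obtain ⟨hL'pos, -⟩ := LFunction_one_re_pos hχ'1 hχ'q.sq_eq_one
  have hLa : (χ.LFunction 1).re ≤ 0.655 * ε * (q : ℝ) ^ (-ε) := by
    rwa [Real.rpow_neg hq0.le, ← div_eq_mul_inv]
  have hL'a : (χ'.LFunction 1).re ≤ 0.655 * ε * (q' : ℝ) ^ (-ε) := by
    rwa [Real.rpow_neg hq'0.le, ← div_eq_mul_inv]
  have hNε : N ^ (-ε) = (q : ℝ) ^ (-ε) * (q' : ℝ) ^ (-ε) := by rw [hN, Real.mul_rpow hq0.le hq'0.le]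
  have hNεexp : N ^ (-ε) = Real.exp (-(ε * L)) := by
    rw [Real.rpow_def_of_pos hN0, hLdef]; congr 1; ring
  have hLL : (χ.LFunction 1).re * (χ'.LFunction 1).re ≤ 0.429025 * ε ^ 2 * Real.exp (-(ε * L)) := by
    have := mul_le_mul hLa hL'a hL'pos.le (by positivity)
    rw [← hNεexp, hNε]
    calc (χ.LFunction 1).re * (χ'.LFunction 1).re
        ≤ 0.655 * ε * (q : ℝ) ^ (-ε) * (0.655 * ε * (q' : ℝ) ^ (-ε)) := this
      _ = 0.429025 * ε ^ 2 * ((q : ℝ) ^ (-ε) * (q' : ℝ) ^ (-ε)) := by ring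
  -- (*) `1.63 κ e^{−2κL} ≤ 0.429025 ε² e^{−εL} (L/2 + 1.3)`
  have hNκ : N ^ (-(2 * (1 - β))) = Real.exp (-(2 * κ * L)) := by
    rw [Real.rpow_def_of_pos hN0, hLdef, hκdef]; congr 1; ring
  have hu0 : 0 < L / 2 + 1.3 := by positivity
  have hstar : 1.63 * κ * Real.exp (-(2 * κ * L)) ≤
      0.429025 * ε ^ 2 * Real.exp (-(ε * L)) * (L / 2 + 1.3) := by
    have h1 := hcore
    rw [hNκ, ← hκdef] at h1
    calc 1.63 * κ * Real.exp (-(2 * κ * L))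
        ≤ (χ.LFunction 1).re * ((χ'.LFunction 1).re * (L / 2 + 1.3)) := h1
      _ = ((χ.LFunction 1).re * (χ'.LFunction 1).re) * (L / 2 + 1.3) := by ring
      _ ≤ 0.429025 * ε ^ 2 * Real.exp (-(ε * L)) * (L / 2 + 1.3) :=
          mul_le_mul_of_nonneg_right hLL hu0.le
  -- convexity: `κ e^{−2κL} ≥ min(f(0.31/L), f(ε/4))`
  have hmin := min_endpoints_le_mul_exp (a := 0.31 / L) (b := ε / 4) (κ := κ) hL0 (by positivity)
    hcon hκε
  rcases min_le_iff.1 hmin with hA | hB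
  · -- (36): left endpoint `κ = 0.31/L`
    have h062 : Real.exp (-(2 * (0.31 / L) * L)) = Real.exp (-0.62) := by
      congr 1; field_simp; ring
    rw [h062] at hA
    have hexp : (0.38 : ℝ) ≤ Real.exp (-0.62) := by
      have := Real.add_one_le_exp (-0.62 : ℝ); norm_num at this ⊢; linarith
    have hsq := sq_mul_exp_neg_le huL
    have he2 := exp_neg_two_le
    -- `ε² e^{−εL} L² ≤ 0.5424`
    have hεL : ε ^ 2 * Real.exp (-(ε * L)) * L ^ 2 ≤ 0.5424 := by
      have e : ε ^ 2 * Real.exp (-(ε * L)) * L ^ 2 = (ε * L) ^ 2 * Real.exp (-(ε * L)) := by ring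
      rw [e]; linarith
    -- combine: `1.63·(0.31/L)·0.38 ≤ 0.429025·(0.5424/L²)(L/2+1.3)` contradicts `L ≥ 22.4`
    have hlow : 1.63 * (0.31 / L) * 0.38 ≤
        0.429025 * ε ^ 2 * Real.exp (-(ε * L)) * (L / 2 + 1.3) := by
      calc 1.63 * (0.31 / L) * 0.38 ≤ 1.63 * (0.31 / L) * Real.exp (-0.62) := by gcongr
        _ = 1.63 * ((0.31 / L) * Real.exp (-0.62)) := by ring
        _ ≤ 1.63 * (κ * Real.exp (-(2 * κ * L))) := mul_le_mul_of_nonneg_left hA (by norm_num)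
        _ = 1.63 * κ * Real.exp (-(2 * κ * L)) := by ring
        _ ≤ _ := hstar
    have hmul : 1.63 * 0.31 * 0.38 * L ≤
        0.429025 * (ε ^ 2 * Real.exp (-(ε * L)) * L ^ 2) * (L / 2 + 1.3) := by
      have := mul_le_mul_of_nonneg_right hlow (sq_nonneg L)
      have e1 : 1.63 * (0.31 / L) * 0.38 * L ^ 2 = 1.63 * 0.31 * 0.38 * L := by field_simp
      rw [e1] at this
      linarith
    have hfin := mul_le_mul_of_nonneg_right hεL hu0.le
    linarith [hfin, hL22, hmul]
  · -- (37): right endpoint `κ = ε/4`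
    have h4 : Real.exp (-(2 * (ε / 4) * L)) = Real.exp (-(ε * L / 2)) := by congr 1; ring
    rw [h4] at hB
    set A : ℝ := Real.exp (-(ε * L / 2)) with hAdef
    have hA0 : 0 < A := Real.exp_pos _
    have hAA : Real.exp (-(ε * L)) = A * A := by rw [hAdef, ← Real.exp_add]; congr 1; ring
    have hAB : A * Real.exp (ε * L / 2) = 1 := by
      rw [hAdef, ← Real.exp_add]; norm_num
    have hquad := Real.quadratic_le_exp_of_nonneg (show (0 : ℝ) ≤ ε * L / 2 by positivity)
    -- from `hB` and `hstar`: `1.63 (ε/4) A ≤ 0.429025 ε² A² (L/2+1.3)`, i.e.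
    -- `0.4075 ≤ 0.429025 ε A (L/2+1.3)`
    have h1 : 1.63 * (ε / 4) * A ≤ 0.429025 * ε ^ 2 * (A * A) * (L / 2 + 1.3) := by
      rw [← hAA]
      calc 1.63 * (ε / 4) * A = 1.63 * (ε / 4 * A) := by ring
        _ ≤ 1.63 * (κ * Real.exp (-(2 * κ * L))) := mul_le_mul_of_nonneg_left hB (by norm_num)
        _ = 1.63 * κ * Real.exp (-(2 * κ * L)) := by ring
        _ ≤ _ := hstar
    have h2 : 0.4075 ≤ 0.429025 * ε * A * (L / 2 + 1.3) := by
      have hεA : 0 < ε * A := mul_pos hε hA0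
      have h1' : (ε * A) * 0.4075 ≤ (ε * A) * (0.429025 * ε * A * (L / 2 + 1.3)) := by
        have e1 : (ε * A) * 0.4075 = 1.63 * (ε / 4) * A := by ring
        have e2 : (ε * A) * (0.429025 * ε * A * (L / 2 + 1.3)) =
            0.429025 * ε ^ 2 * (A * A) * (L / 2 + 1.3) := by ring
        rw [e1, e2]; exact h1
      exact le_of_mul_le_mul_left h1' hεA
    -- multiply by `e^{εL/2}`: `0.4075 e^{εL/2} ≤ 0.429025 ε (L/2+1.3)`
    have h3 : 0.4075 * Real.exp (ε * L / 2) ≤ 0.429025 * ε * (L / 2 + 1.3) := by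
      have := mul_le_mul_of_nonneg_right h2 (Real.exp_pos (ε * L / 2)).le
      calc 0.4075 * Real.exp (ε * L / 2)
          ≤ 0.429025 * ε * A * (L / 2 + 1.3) * Real.exp (ε * L / 2) := this
        _ = 0.429025 * ε * (L / 2 + 1.3) * (A * Real.exp (ε * L / 2)) := by ring
        _ = 0.429025 * ε * (L / 2 + 1.3) := by rw [hAB, mul_one]
    -- contradiction with `e^{u/2} ≥ 1 + u/2 + u²/8`, `u² ≥ 2u`, `ε < 1/2`
    have hu2 : 2 * (ε * L) ≤ (ε * L) ^ 2 := by
      have h0 : 0 ≤ (ε * L) * (ε * L - 2) := mul_nonneg (by linarith) (by linarith)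
      linarith [h0]
    linarith [h3, hquad, hu2, hε2, huL]

/-! ### Part B4: Lemma 11 replaced by McCurley's explicit Landau theorem; Theorem 2 pairwise -/

/-- **Theorem 2, pairwise, `0 < ε < ½`**: of two real primitive characters `χ₁ ≠ χ₂` with moduli
`k₁, k₂ ≥ max(e^{1/ε}, e^{11.2})`, at least one satisfies `L(1,χ) > 0.655 ε/k^ε`. Proof (§4 pp. 176–177):
assuming (35) both fail, Lemma 9 gives real zeros `β_i ∈ (1 − ε/4, 1)` of `L(s,χ_i)`; by (36)–(37)
(`one_sub_lt_of_realZero`) both satisfy `1 − β_i < 0.31/log k₁k₂`; Tatuzawa's Lemma 11 ("`G(s)` has at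
most two real zeros in `1 − 1/(8 log k₁k₂) ≤ s < 1`" plus the sign change of `G` at `1⁻`) is replaced by
McCurley's explicit Landau theorem `McCurley1984_theorem2_holds` (`min{β₁,β₂} < 1 − 0.3103/log M`,
`M = max(k₁k₂/17, 13) ≤ k₁k₂`), which two such zeros contradict directly.
[cite: Tatuzawa1951, Theorem 2 p. 164, §4 pp. 176–177] [cite: McCurley1984ZFR, Theorem 2] -/
theorem theorem2_pair {ε : ℝ} (hε : 0 < ε) (hε2 : ε < 1 / 2)
    {k₁ : ℕ} [NeZero k₁] (χ₁ : DirichletCharacter ℂ k₁) (h₁p : χ₁.IsPrimitive) (h₁q : χ₁.IsQuadratic)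
    {k₂ : ℕ} [NeZero k₂] (χ₂ : DirichletCharacter ℂ k₂) (h₂p : χ₂.IsPrimitive) (h₂q : χ₂.IsQuadratic)
    (hne : (fun n : ℕ ↦ χ₁ n) ≠ fun n : ℕ ↦ χ₂ n)
    (hk₁ : max (Real.exp (1 / ε)) (Real.exp 11.2) ≤ (k₁ : ℝ))
    (hk₂ : max (Real.exp (1 / ε)) (Real.exp 11.2) ≤ (k₂ : ℝ)) :
    0.655 * ε / (k₁ : ℝ) ^ ε < (χ₁.LFunction 1).re ∨
      0.655 * ε / (k₂ : ℝ) ^ ε < (χ₂.LFunction 1).re := by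
  obtain ⟨hk₁ε, hk₁11⟩ := max_le_iff.1 hk₁
  obtain ⟨hk₂ε, hk₂11⟩ := max_le_iff.1 hk₂
  by_contra hcon
  push Not at hcon
  obtain ⟨hL₁, hL₂⟩ := hcon
  obtain ⟨-, hk₁59⟩ := log_ge_of_exp_le hk₁11
  obtain ⟨-, hk₂59⟩ := log_ge_of_exp_le hk₂11
  have hk₁0 : (0 : ℝ) < k₁ := by linarith
  have hk₂0 : (0 : ℝ) < k₂ := by linarith
  -- (35) ⇒ Lemma 9: real zeros `β_i ∈ (1 − ε/4, 1)`
  obtain ⟨β₁, hβ₁lo, hβ₁1, hz₁⟩ :=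
    exists_realZero_of_lOne_le_eps h₁p h₁q hε hε2.le hk₁ε hk₁11 hL₁
  obtain ⟨β₂, hβ₂lo, hβ₂1, hz₂⟩ :=
    exists_realZero_of_lOne_le_eps h₂p h₂q hε hε2.le hk₂ε hk₂11 hL₂
  -- (36)–(37): both zeros lie above `1 − 0.31/log k₁k₂`
  have hβ₂w := one_sub_lt_of_realZero χ₁ χ₂ h₁p h₁q h₂p h₂q hne hε hε2 hk₁ε hk₁11 hk₂ε hk₂11
    hL₁ hL₂ hz₂ hβ₂lo hβ₂1
  have hβ₁w := one_sub_lt_of_realZero χ₂ χ₁ h₂p h₂q h₁p h₁q (fun h ↦ hne h.symm) hε hε2 hk₂ε hk₂11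
    hk₁ε hk₁11 hL₂ hL₁ hz₁ hβ₁lo hβ₁1
  rw [mul_comm (k₂ : ℝ)] at hβ₁w
  -- McCurley 1984, Theorem 2
  have hdist : k₁ ≠ k₂ ∨ ∃ h : k₁ = k₂, h ▸ χ₁ ≠ χ₂ := by
    by_cases h : k₁ = k₂
    · subst h
      refine Or.inr ⟨rfl, fun heq ↦ hne ?_⟩
      funext n
      rw [show χ₁ = χ₂ from heq]
    · exact Or.inl h
  have hMc := McCurley1984_theorem2_holds k₁ k₂ χ₁ χ₂ h₁p h₁q h₂p h₂q hdist β₁ β₂ hz₁ hz₂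
  rw [ThornerZaman2024.one_div_rOne_mul_eq] at hMc
  set c : ℝ := ThornerZaman2024.landauConst with hcdef
  have hc : (0.31 : ℝ) < c := Hoffstein1980.landauConst_gt
  set M : ℝ := max ((k₁ : ℝ) * k₂ / 17) 13 with hMdef
  have hN13 : (13 : ℝ) ≤ (k₁ : ℝ) * k₂ := by nlinarith
  have hMle : M ≤ (k₁ : ℝ) * k₂ := max_le (div_le_self (by positivity) (by norm_num)) hN13
  have hM13 : (13 : ℝ) ≤ M := le_max_right _ _
  have hlogM : Real.log M ≤ Real.log ((k₁ : ℝ) * k₂) := Real.log_le_log (by linarith) hMle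
  have hlogM0 : 0 < Real.log M := Real.log_pos (by linarith)
  have hlogN0 : 0 < Real.log ((k₁ : ℝ) * k₂) := lt_of_lt_of_le hlogM0 hlogM
  -- `0.31/log k₁k₂ < c/log M`: both zeros are inside McCurley's window — contradiction
  have hwin : 0.31 / Real.log ((k₁ : ℝ) * k₂) < c / Real.log M := by
    rw [div_lt_div_iff₀ hlogN0 hlogM0]; nlinarith
  have h1 : 1 - c / Real.log M < β₁ := by linarith
  have h2 : 1 - c / Real.log M < β₂ := by linarith
  exact absurd hMc (not_lt.2 (le_min h1.le h2.le))

end Literature.NumberTheory.LFunctions.Tatuzawa1951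

namespace Literature.NumberTheory.LFunctions

open Tatuzawa1951 in
/-- **Tatuzawa 1951, Theorem 2 (Jap. J. Math. 21, p. 164) — DISCHARGED.** "Let `1 > ε > 0` and
`k ≥ Max(e^{1/ε}, e^{11.2})`. Then `L(1, χ) > 0.655 ε/k^ε` with one possible exception." Proof following
§4 pp. 176–177: `ε ≥ ½` needs no exception (`lOne_gt_of_half_le`, the class-number floor (3));
`0 < ε < ½` is the pairwise argument `theorem2_pair` (Lemma 9, Lemma 10 at the zeros, convexity, and
McCurley's explicit Landau theorem for Lemma 11) turned into "at most one exception" by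
`AtMostOneException.of_pairwise`. [cite: Tatuzawa1951, Theorem 2 p. 164; §4 pp. 176–177] -/
theorem tatuzawa1951_theorem2_holds : tatuzawa1951_theorem2 := by
  intro ε hε hε1
  by_cases hhalf : 1 / 2 ≤ ε
  · refine ⟨fun _ ↦ 0, fun q _ χ hp hq _ _ hmax ↦ ?_⟩
    exact lOne_gt_of_half_le hp hq hhalf hε1 (le_trans (le_max_right _ _) hmax)
  · push Not at hhalf
    refine AtMostOneException.of_pairwise fun {q} _ χ hp hq _ {q'} _ χ' hp' hq' _ hne ↦ ?_
    by_cases h1 : max (Real.exp (1 / ε)) (Real.exp 11.2) ≤ (q : ℝ)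
    · by_cases h2 : max (Real.exp (1 / ε)) (Real.exp 11.2) ≤ (q' : ℝ)
      · rcases theorem2_pair hε hhalf χ hp hq χ' hp' hq' hne h1 h2 with h | h
        · exact Or.inl fun _ ↦ h
        · exact Or.inr fun _ ↦ h
      · exact Or.inr fun h ↦ absurd h h2
    · exact Or.inl fun h ↦ absurd h h1

end Literature.NumberTheory.LFunctions

end
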